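import Literature.NumberTheory.Transcendental.KaehlerHodgeSerreDualityProofs
import Literature.AlgebraicGeometry.Motives.HodgeDecompositionIsInternalDischarge
import HarnessLib

/-!
# Serre duality for Hodge numbers `h^{p,q} = h^{d-p,d-q}` holds (discharge of `hodgeNumber_eq_hodgeNumber_of_add_eq`)

Trunk **T-KAEHLER** (`NumberTheory/Transcendental`). Theorems-only leaf companion of
`KaehlerHodge.lean` (the named fact
`Literature.NumberTheory.Transcendental.hodgeNumber_eq_hodgeNumber_of_add_eq`: on a compact Hausdorff
complex manifold `M` of complex dimension `d = dim_ℂ E`, `h^{p,q} = h^{p',q'}` whenever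
`p + p' = d = q + q'`; J.-P. Serre, *Un théorème de dualité* (1955); D. Huybrechts, *Complex Geometry*
(2005), Prop. 4.1.15 with Cor. 4.1.16 and Rem. 3.2.7 (ii), p. 127 ("Serre duality on the level of
harmonic forms"); C. Voisin, *Hodge Theory and Complex Algebraic Geometry I* (2002), §5.3.2
Thm. 5.32) and of its reduction file `KaehlerHodgeSerreDualityProofs.lean`, whose
`hodgeNumber_eq_hodgeNumber_of_add_eq_of_regularity_of_compactness` — "the term that discharges
`hodgeNumber_eq_hodgeNumber_of_add_eq` once the elliptic theory of `Δ_∂̄` is in the tree (with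
`n := finrank ℝ E`, `Fact.mk rfl`)" — reduces the fact, WITHOUT any Kähler identity, to Warner's
Theorems 6.6 (`hC`, compactness) and 6.5 (`hR`, regularity) for `Δ_∂̄` on the Hermitian inner product
spaces `A^{p,q}(M)` (`CL2SmoothForms.pq o p q`) of every smooth Hermitian metric `g` and orientation
family `o` with smooth volume form (Voisin (2002), Thm. 5.22 ⇒ Thm. 5.24 ⇒ Thm. 5.32 via the
conjugate-linear Hodge star `α ↦ ⋆ᾱ : ℋ^{p,q} ≅ ℋ^{d-p,d-q}`).

Both inputs are THEOREMS of the tree's periodic-elliptic programme: `CL2SmoothForms.pq_compact`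
(`Literature/Geometry/Kaehler/TorusDolbeaultCompactAll.lean`) and `CL2SmoothForms.pq_regular`
(`Literature/Geometry/Kaehler/TorusDolbeaultRegularityPq.lean`), in exactly the binder shape the
assembly asks for — the same feeding as for the Hodge decomposition
(`Literature.AlgebraicGeometry.Motives.HodgeDecompositionIsInternalDischarge`) and for Hodge symmetry
(`KaehlerHodgeSymmDischarge.lean`).

* **`hodgeNumber_eq_hodgeNumber_of_add_eq_holds`** — discharge of the named fact.
* `hodgeNumber_eq_hodgeNumber_sub` — the subtraction form `h^{p,q} = h^{d-p,d-q}` for `p, q ≤ d`.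
* `hodgeNumber_eq_hodgeNumber_top` — `h^{0,0} = h^{d,d}`, and `hodgeNumber_zero_top_eq` —
  `h^{0,d} = h^{d,0}` (both instances of the duality; the second is NOT Hodge symmetry: no Kähler
  hypothesis).

No definition and no named fact is introduced (D-0026).

## References

* J.-P. Serre, *Un théorème de dualité*, Comment. Math. Helv. 29 (1955), 9–26. [Serre1955Dualite]
* D. Huybrechts, *Complex Geometry* (2005), Rem. 3.2.7 (ii) p. 127, Prop. 4.1.15, Cor. 4.1.16.
  [Huybrechts2005]
* C. Voisin, *Hodge Theory and Complex Algebraic Geometry I* (2002), §5.3.1 Thm. 5.22, Thm. 5.24,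
  §5.3.2 Thm. 5.32. [Voisin2002] [VoisinHodgeI2002]
* F. W. Warner, *Foundations of Differentiable Manifolds and Lie Groups*, GTM 94 (1983), Thms. 6.5,
  6.6. [WarnerGTM94]
-/

noncomputable section

open scoped Manifold ContDiff Topology
open Bundle Module Literature.Geometry.Kaehler Literature.AlgebraicGeometry.Motives

namespace Literature.NumberTheory.Transcendental

-- The identification `TangentSpace I x = E` is an abuse of definitional equality (see
-- `NormedSpace.fromTangentSpace`); as in Mathlib's tangent-bundle files we let `isDefEq` unfold it.
set_option backward.isDefEq.respectTransparency false

variable {E : Type*} [NormedAddCommGroup E] [NormedSpace ℂ E] [FiniteDimensional ℂ E]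
  {M : Type*} [TopologicalSpace M] [ChartedSpace E M]
  [IsManifold 𝓘(ℂ, E) ω M] [IsManifold 𝓘(ℝ, E) ∞ M]

/-- **Serre duality for Hodge numbers** (discharge of the named fact
`hodgeNumber_eq_hodgeNumber_of_add_eq`): on a compact Hausdorff complex manifold of complex dimension
`d = dim_ℂ E`, `h^{p,q} = h^{p',q'}` whenever `p + p' = d` and `q + q' = d`. The tree's assembly
`hodgeNumber_eq_hodgeNumber_of_add_eq_of_regularity_of_compactness` at `n := dim_ℝ E`, fed Warner's
Theorems 6.6 / 6.5 for `Δ_∂̄` (`CL2SmoothForms.pq_compact`, `CL2SmoothForms.pq_regular`).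
[cite: Huybrechts2005, Prop. 4.1.15, Cor. 4.1.16; Rem. 3.2.7 (ii), p. 127] -/
theorem hodgeNumber_eq_hodgeNumber_of_add_eq_holds :
    hodgeNumber_eq_hodgeNumber_of_add_eq (E := E) (M := M) := by
  intro _ _ p q p' q' hp hq
  haveI : Fact (finrank ℝ E = finrank ℝ E) := ⟨rfl⟩
  refine hodgeNumber_eq_hodgeNumber_of_add_eq_of_regularity_of_compactness
    (E := E) (M := M) (n := finrank ℝ E) ?_ ?_ hp hq
  · intro g o m _ _ _ _ hJ p q h ho
    letI : RiemannianBundle (fun x : M ↦ TangentSpace 𝓘(ℝ, E) x) := ⟨g.toRiemannianMetric⟩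
    haveI : IsContMDiffRiemannianBundle 𝓘(ℝ, E) ∞ E (fun x : M ↦ TangentSpace 𝓘(ℝ, E) x) :=
      ⟨g.inner, g.contMDiff, fun _ _ _ ↦ rfl⟩
    haveI : Fact (IsSmoothForm (riemannianVolumeForm o)) := ⟨ho⟩
    exact fun u c hb hΔ ↦ CL2SmoothForms.pq_compact o hJ p q h u c hb hΔ
  · intro g o m _ _ _ _ hJ p q h ho
    letI : RiemannianBundle (fun x : M ↦ TangentSpace 𝓘(ℝ, E) x) := ⟨g.toRiemannianMetric⟩
    haveI : IsContMDiffRiemannianBundle 𝓘(ℝ, E) ∞ E (fun x : M ↦ TangentSpace 𝓘(ℝ, E) x) :=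
      ⟨g.inner, g.contMDiff, fun _ _ _ ↦ rfl⟩
    haveI : Fact (IsSmoothForm (riemannianVolumeForm o)) := ⟨ho⟩
    exact fun α ℓ hw ↦ CL2SmoothForms.pq_regular o hJ p q h α ℓ hw

/-- **Serre duality for Hodge numbers, subtraction form**: `h^{p,q} = h^{d-p,d-q}` for `p, q ≤ d`
on a compact Hausdorff complex manifold of complex dimension `d = dim_ℂ E`.
[cite: Huybrechts2005, Cor. 4.1.16] -/
theorem hodgeNumber_eq_hodgeNumber_sub [CompactSpace M] [T2Space M] {p q : ℕ}
    (hp : p ≤ finrank ℂ E) (hq : q ≤ finrank ℂ E) :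
    hodgeNumber E M p q = hodgeNumber E M (finrank ℂ E - p) (finrank ℂ E - q) :=
  hodgeNumber_eq_hodgeNumber_of_add_eq_holds (E := E) (M := M) (by omega) (by omega)

/-- `h^{0,0} = h^{d,d}` on a compact Hausdorff complex manifold of complex dimension `d`.
[cite: Huybrechts2005, Cor. 4.1.16] -/
theorem hodgeNumber_eq_hodgeNumber_top [CompactSpace M] [T2Space M] :
    hodgeNumber E M 0 0 = hodgeNumber E M (finrank ℂ E) (finrank ℂ E) :=
  hodgeNumber_eq_hodgeNumber_of_add_eq_holds (E := E) (M := M) (zero_add _) (zero_add _)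

/-- `h^{0,d} = h^{d,0}` on a compact Hausdorff complex manifold of complex dimension `d` — an
instance of Serre duality valid without any Kähler hypothesis (Huybrechts (2005), Cor. 4.1.16; it is
not Hodge symmetry). [cite: Huybrechts2005, Cor. 4.1.16] -/
theorem hodgeNumber_zero_top_eq [CompactSpace M] [T2Space M] :
    hodgeNumber E M 0 (finrank ℂ E) = hodgeNumber E M (finrank ℂ E) 0 :=
  hodgeNumber_eq_hodgeNumber_of_add_eq_holds (E := E) (M := M) (zero_add _) (add_zero _)

end Literature.NumberTheory.Transcendental

end
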